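import Literature.MathematicalPhysics.QuantumFieldTheory.BalabanImbrieJaffe1984to88.BIJ88Vj5610Operator
import Mathlib.Analysis.Matrix.Normed

/-!
# `BalabanImbrieJaffe1984to88.BIJ88Eq5612W6` — T. Bałaban, J. Imbrie, A. Jaffe, *Effective action and cluster properties of the abelian
Higgs model*, Commun. Math. Phys. **114** (1988) 257–315 [BalabanImbrieJaffe1988], Sect. 5.6 pp. 287–288 [PDF 31–32]: the localized
resolvent expansion **(5.6.12) WITH its kernel `w₆`** — the two displays at the foot of p. 287 and (5.6.12) DERIVED, with `w₆` given
EXPLICITLY in terms of the one-step defect `w′₆` and bounded by it (companion of this seat's `BIJ88Vj5610Operator`, which computes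
`V_j(Ω)` of (5.6.10)).

statement-level skeleton of published theorems with citation tags; proofs where landed; nothing here is a claim about the Yang–Mills mass gap

PDF held: `paper:balaban1988-cmp114-bij-abelian-higgs-effective-action` (journal page = PDF page + 256); pp. 287–288 [PDF 31–32] read as
images this session (seat folder `pages/original-p031-x2.png`, `pages/original-p032-x2.png`, CCITT renders).

CITATION HEADER (lean-in-tree rule).  Part of the lit-balaban TYPED SKELETON (HOME `run/shared/lean/pub/lit-balaban/`), PHASE-2 proof
seat p31 gen 10 (unit `lit-balaban-p31-g10`; TAKING line HOME/STATUS.md 2026-08-22T00:11Z, second file).  WHAT IS REPRODUCED: row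
`C2.Eq5.6.6-5.6.12` of `HOME/lit-balaban-r16/ROWS-C2-part2.md` (owner r16), member (5.6.12) and the two preceding displays, p. 287
[PDF 31] – p. 288 [PDF 32], verbatim: *"We insert this into G_{j,loc}(ũ_{k+1}ũ) to obtain G_{j,loc}(ũ_{k+1}ũ)(x₁,x₂) = G_{j,loc}(ũ_{k+1})
(x₁,x₂) + ζ″_j(x₁,x₂) Σ_α λ_α(G_j(□_α, ũ_{k+1})V_jG_j(□_α, ũ_{k+1}ũ))(x₁,x₂). The second term can be changed slightly by changing the set
□_α in G_j and changing the tails of the operators. The difference is w′₆, a small (O(e^{−cr(e_j)})), local kernel with small covariant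
derivatives, and depending only locally on ũ_{k+1}, ũ. We obtain G_{j,loc}(ũ_{k+1}ũ) = G_{j,loc}(ũ_{k+1}) + G_{j,loc}(ũ_{k+1})V_jG_{j,loc}
(ũ_{k+1}ũ) + w′₆. This is now iterated to yield G_{j,loc}(ũ_{k+1}ũ) = Σ_{n=0}^{n̄} G_{j,loc}(ũ_{k+1})[V_jG_{j,loc}(ũ_{k+1})]ⁿ + G_{j,loc}
(ũ_{k+1})[V_jG_{j,loc}(ũ_{k+1})]^{n̄}V_jG_{j,loc}(ũ_{k+1}ũ) + w₆, (5.6.12) with another small kernel w₆."*  In the tree before this file: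
r16's `BIJ88Sect5StatementsPart4.eq5612` proves the iteration for an EXACT resolvent pair (`g₀a = 1`, `(a − v)g = 1`) *"to every
order N WITHOUT the kernel w₆"*; `G_{k,loc} = ζ″_kG̃_k`, `G̃_k = Σ_α λ_αG_k(□_α)` are r18's (2.28) `loc` / (2.27) `convexComb`
(`BIJ88Sect2Statements`).

THE MECHANISM.  (i) `G_{j,loc}(u) := ζ″_j · Σ_α λ_αG_j(□_α, u)` entrywise ((2.27)–(2.28) at step `j`; `gLoc`, = r18's `loc ζ″ (convexComb
λ ·)` for real kernels, `gLoc_eq_loc_convexComb`).  Inserting the per-cube resolvent identity (5.6.11) `G_j(□_α, ũ_{k+1}ũ) = G_j(□_α,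
ũ_{k+1}) + G_j(□_α, ũ_{k+1})V_j(□_α)G_j(□_α, ũ_{k+1}ũ)` (this seat's `BIJ88Vj5610Operator.eq5611_matrix` with the Neumann cut-off of `□_α`)
entry by entry gives the first display (`gLoc_insert5611`) — note the region-dependence `V_j = V_j(□_α)`.  (ii) The second display
DEFINES `w′₆` as the difference made by *"changing the set □_α in G_j and changing the tails"*: `w′₆ := ζ″_jΣ_α λ_α(G_j(□_α,ũ_{k+1})
V_j(□_α)G_j(□_α,ũ_{k+1}ũ)) − G_{j,loc}(ũ_{k+1})V_jG_{j,loc}(ũ_{k+1}ũ)` (`w6prime`; the `V_j` of the changed form is a parameter — print does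
not pin its region), so that the second display `g = g₀ + g₀vg + w′₆` (`g₀ = G_{j,loc}(ũ_{k+1})`, `g = G_{j,loc}(ũ_{k+1}ũ)`, `v = V_j`) holds
EXACTLY (`oneStep_w6prime`); its smallness `O(e^{−cr(e_j)})` is the printed CLAIM (random-walk/localization estimates of Sect. 2 for
`G_j(□, u)`), not derived here.  (iii) Substituting the one-step identity into itself `n̄` times yields (5.6.12) EXACTLY with
  `w₆ = Σ_{n=0}^{n̄} (g₀v)ⁿ w′₆`   (`w6`; **`eq5612_w6`** in any ring, **`eq5612_gLoc`** for `G_{j,loc}` given only the per-cube (5.6.11),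
  **`eq5612_neumann`** for the operators of record: the inverses of `BIJ88Vj5610Operator.hMat` on the cubes and the COMPUTED `V_j = vjMat`)
— so `w₆` is an explicit finite sum of operators applied to `w′₆`, and in any normed ring `‖w₆‖ ≤ (Σ_{n=0}^{n̄} θⁿ)·‖w′₆‖` for
`‖g₀v‖ ≤ θ` (**`norm_w6_le`**), `≤ (n̄+1)‖w′₆‖` for `θ ≤ 1`, `≤ ‖w′₆‖/(1 − θ)` for `θ < 1` (`norm_w6_le_geom`): *"another small kernel
w₆"* ⇐ *"w′₆ small"* and `‖G_{j,loc}V_j‖ ≤ θ` (print: *"The terms in V_j are small … bounded kernels"* + the regularity of `G_{j,loc}`).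
For kernels = complex matrices with the `ℓ^∞`-operator norm (= the maximal ROW SUM `sup_{x₁}Σ_{x₂}|K(x₁,x₂)|`, Mathlib's scoped
`Matrix.Norms.Operator`; `norm_eq_rowSum`) this is `norm_w6_matrix_le`.

WHAT IS PROVED (0 `sorry`, standard axioms; three definitions with bodies (`gLoc`, `w6`, `w6prime`) + theorems, no `Prop` facts).
* §1 `gLoc`, `gLoc_apply`, `gLoc_eq_loc_convexComb` (= r18's (2.27)–(2.28) for real kernels), **`gLoc_insert5611`** (the first p. 287
  display from the per-cube (5.6.11)).
* §2 `w6`, `w6_zero`, `w6_succ`, **`eq5612_w6`** ((5.6.12) with `w₆`, every `n̄`, any ring, from the one-step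
  identity), `eq5612_w6_zero_defect` (`w′₆ = 0` ⇒ r16's shape `eq5612`).
* §3 `w6prime`, **`oneStep_w6prime`** (the second p. 287 display, exact), **`eq5612_gLoc`**, **`eq5612_neumann`**.
* §4 **`norm_w6_le`**, `norm_w6_le_of_le_one`, `norm_w6_le_geom` (any normed ring), `norm_w6_matrix_le`, `norm_eq_rowSum` (complex matrices,
  row-sum operator norm).
HONEST SCOPE.  Algebra and norm bookkeeping: the per-cube invertibility (`G_αH_α = 1`, `H′_αG′_α = 1`) and the bound `‖G_{j,loc}V_j‖ ≤ θ`
are HYPOTHESES displayed in the statements; the smallness `w′₆ = O(e^{−cr(e_j)})` (*"local kernel with small covariant derivatives"*)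
is NOT derived — it needs the Sect. 2 localization estimates for `G_j(□, u)` — and therefore neither is an absolute size of `w₆`: what is
proved is the exact formula for `w₆` and `w₆ = O(w′₆)`.  Unit `lit-balaban-p31` (literature-prover-lit-balaban-p31-g10-0), 2026-08-22.
NOT summit progress.
-/

namespace Literature.MathematicalPhysics.QuantumFieldTheory.BalabanImbrieJaffe1984to88.BIJ88Eq5612W6

open Literature.MathematicalPhysics.QuantumFieldTheory.Balaban1983to89
open BIJ88Sect2Statements (loc convexComb)
open BIJ88Sect5Statements (eq5611)
open BIJ88Vj5610Operator (hMat vjMat chiN eq5611_matrix)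
open scoped BigOperators Matrix
open Complex Matrix Finset

noncomputable section

/-! ## §1 `G_{j,loc} = ζ″_j Σ_α λ_α G_j(□_α)` and the first display of p. 287 -/

section GLoc

variable {R : Type*} [CommRing R] {σ ι : Type*} [Fintype ι]

/-- `G_{j,loc}(u)(x₁,x₂) = ζ″_j(x₁,x₂)·Σ_α λ_α(x₁,x₂)G_j(□_α,u)(x₁,x₂)` — (2.27)–(2.28) at step `j` (a cut-off convex combination of the
propagators of the cubes `□_α`), for kernels with entries in a commutative ring `R` (`ℝ`: r18's `loc`/`convexComb`; `ℂ`: the covariant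
scalar propagators). [cite: BalabanImbrieJaffe1988, (2.28) p.263] -/
def gLoc (ζ'' : σ → σ → R) (lam : ι → σ → σ → R) (G : ι → Matrix σ σ R) : Matrix σ σ R :=
  Matrix.of fun x₁ x₂ => ζ'' x₁ x₂ * ∑ α, lam α x₁ x₂ * G α x₁ x₂

/-- kernel: the entries of `gLoc`. [cite: BalabanImbrieJaffe1988, (2.28) p.263] -/
theorem gLoc_apply (ζ'' : σ → σ → R) (lam : ι → σ → σ → R) (G : ι → Matrix σ σ R) (x₁ x₂ : σ) :
    gLoc ζ'' lam G x₁ x₂ = ζ'' x₁ x₂ * ∑ α, lam α x₁ x₂ * G α x₁ x₂ := rfl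

/-- kernel: for real kernels `gLoc` IS r18's (2.28)∘(2.27) `loc ζ″ (convexComb λ G)` of `BIJ88Sect2Statements`.
[cite: BalabanImbrieJaffe1988, (2.27) p.263] -/
theorem gLoc_eq_loc_convexComb (ζ'' : σ → σ → ℝ) (lam : ι → σ → σ → ℝ) (G : ι → Matrix σ σ ℝ) (x₁ x₂ : σ) :
    gLoc ζ'' lam G x₁ x₂ = loc ζ'' (convexComb lam fun α => G α) x₁ x₂ := rfl

/-- **the first display at the foot of p. 287**, verbatim: *"We insert this into G_{j,loc}(ũ_{k+1}ũ) to obtain G_{j,loc}(ũ_{k+1}ũ)(x₁,x₂) =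
G_{j,loc}(ũ_{k+1})(x₁,x₂) + ζ″_j(x₁,x₂) Σ_α λ_α(G_j(□_α, ũ_{k+1})V_jG_j(□_α, ũ_{k+1}ũ))(x₁,x₂)."* — DERIVED entry by entry from the per-cube
resolvent identity (5.6.11) (`G′_α = G_α + G_αV_αG′_α`, `V_α = V_j(□_α)`). [cite: BalabanImbrieJaffe1988, (5.6.11) p.287] -/
theorem gLoc_insert5611 [Fintype σ] (ζ'' : σ → σ → R) (lam : ι → σ → σ → R) {G G' V : ι → Matrix σ σ R}
    (h : ∀ α, G' α = G α + G α * V α * G' α) :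
    gLoc ζ'' lam G' = gLoc ζ'' lam G + Matrix.of fun x₁ x₂ => ζ'' x₁ x₂ * ∑ α, lam α x₁ x₂ * (G α * V α * G' α) x₁ x₂ := by
  ext x₁ x₂
  simp only [gLoc, Matrix.add_apply, Matrix.of_apply, ← mul_add, ← Finset.sum_add_distrib]
  congr 1
  exact Finset.sum_congr rfl fun α _ => by rw [h α, Matrix.add_apply, ← h α, mul_add]

end GLoc


/-! ## §2 (5.6.12) with the kernel `w₆` -/

section Iterate

variable {R : Type*} [Ring R]

/-- **the kernel `w₆` of (5.6.12) after `N` iterations**: `w₆ := Σ_{n=0}^{N} (g₀v)ⁿ w′₆` — the one-step defect `w′₆` propagated through the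
iteration (`g₀ = G_{j,loc}(ũ_{k+1})`, `v = V_j`). [cite: BalabanImbrieJaffe1988, (5.6.12) p.288] -/
def w6 (g₀ v w' : R) (N : ℕ) : R := ∑ n ∈ Finset.range (N + 1), (g₀ * v) ^ n * w'

/-- kernel: no iteration — `w₆ = w′₆`. [cite: BalabanImbrieJaffe1988, (5.6.12) p.288] -/
theorem w6_zero (g₀ v w' : R) : w6 g₀ v w' 0 = w' := by
  simp [w6]

/-- kernel: one more iteration adds `(g₀v)^{N+1}w′₆`. [cite: BalabanImbrieJaffe1988, (5.6.12) p.288] -/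
theorem w6_succ (g₀ v w' : R) (N : ℕ) : w6 g₀ v w' (N + 1) = w6 g₀ v w' N + (g₀ * v) ^ (N + 1) * w' := by
  rw [w6, Finset.sum_range_succ, ← w6]

/-- kernel: `g₀(vg₀)ⁿ = (g₀v)ⁿg₀`. [folklore] -/
private theorem mul_pow_mul_eq_pow_mul (g₀ v : R) (n : ℕ) : g₀ * (v * g₀) ^ n = (g₀ * v) ^ n * g₀ := by
  induction n with
  | zero => simp
  | succ n ih => rw [pow_succ, ← mul_assoc, ih, pow_succ, mul_assoc, mul_assoc, mul_assoc]

/-- **(5.6.12) with `w₆`** p. 288 [PDF 32], verbatim: *"This is now iterated to yield G_{j,loc}(ũ_{k+1}ũ) = Σ_{n=0}^{n̄} G_{j,loc}(ũ_{k+1})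
[V_jG_{j,loc}(ũ_{k+1})]ⁿ + G_{j,loc}(ũ_{k+1})[V_jG_{j,loc}(ũ_{k+1})]^{n̄}V_jG_{j,loc}(ũ_{k+1}ũ) + w₆, (5.6.12) with another small kernel w₆."* —
DERIVED for every `n̄ = N` from the one-step identity of p. 287 `g = g₀ + g₀vg + w′₆` (any ring; `g₀ = G_{j,loc}(ũ_{k+1})`, `g =
G_{j,loc}(ũ_{k+1}ũ)`, `v = V_j`), with `w₆ = Σ_{n=0}^{N}(g₀v)ⁿw′₆` EXPLICIT (`w6`). [cite: BalabanImbrieJaffe1988, (5.6.12) p.288] -/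
theorem eq5612_w6 {g₀ v g w' : R} (h : g = g₀ + g₀ * v * g + w') (N : ℕ) :
    g = (∑ n ∈ Finset.range (N + 1), g₀ * (v * g₀) ^ n) + g₀ * (v * g₀) ^ N * v * g + w6 g₀ v w' N := by
  induction N with
  | zero => simpa [w6] using h
  | succ N ih =>
    have key : g₀ * (v * g₀) ^ N * v * g
        = g₀ * (v * g₀) ^ (N + 1) + g₀ * (v * g₀) ^ (N + 1) * v * g + (g₀ * v) ^ (N + 1) * w' := by
      conv_lhs => rw [h]
      rw [mul_pow_mul_eq_pow_mul g₀ v N, mul_pow_mul_eq_pow_mul g₀ v (N + 1), pow_succ]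
      noncomm_ring
    calc g = (∑ n ∈ Finset.range (N + 1), g₀ * (v * g₀) ^ n) + g₀ * (v * g₀) ^ N * v * g + w6 g₀ v w' N := ih
      _ = _ := by
        rw [key]
        conv_rhs => rw [Finset.sum_range_succ, w6_succ]
        abel

/-- kernel: with no defect (`w′₆ = 0`, an exact resolvent pair) `w₆ = 0` and (5.6.12) is r16's `eq5612` shape.
[cite: BalabanImbrieJaffe1988, (5.6.12) p.288] -/
theorem eq5612_w6_zero_defect {g₀ v g : R} (h : g = g₀ + g₀ * v * g) (N : ℕ) :
    g = (∑ n ∈ Finset.range (N + 1), g₀ * (v * g₀) ^ n) + g₀ * (v * g₀) ^ N * v * g := by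
  have h' : g = g₀ + g₀ * v * g + 0 := by rw [add_zero]; exact h
  have := eq5612_w6 h' N
  simpa [w6] using this

end Iterate

/-! ## §3 `w′₆` as the defect of the one-step identity, and (5.6.12) for `G_{j,loc}` unconditionally -/

section W6prime

variable {R : Type*} [CommRing R] {σ ι : Type*} [Fintype σ] [Fintype ι]

/-- **the kernel `w′₆`** — p. 287, verbatim: *"The second term can be changed slightly by changing the set □_α in G_j and changing the
tails of the operators. The difference is w′₆"*: `w′₆ := ζ″_jΣ_α λ_α(G_j(□_α,ũ_{k+1})V_j(□_α)G_j(□_α,ũ_{k+1}ũ)) − G_{j,loc}(ũ_{k+1})V_jG_{j,loc}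
(ũ_{k+1}ũ)` (the second term of the first display minus its *"changed"* form; `Vj` = the `V_j` of the changed form, a parameter).
[cite: BalabanImbrieJaffe1988, (5.6.12) p.287] -/
def w6prime (ζ'' : σ → σ → R) (lam : ι → σ → σ → R) (G V G' : ι → Matrix σ σ R) (Vj : Matrix σ σ R) : Matrix σ σ R :=
  (Matrix.of fun x₁ x₂ => ζ'' x₁ x₂ * ∑ α, lam α x₁ x₂ * (G α * V α * G' α) x₁ x₂)
    - gLoc ζ'' lam G * Vj * gLoc ζ'' lam G'

/-- **the second display at the foot of p. 287**, verbatim: *"We obtain G_{j,loc}(ũ_{k+1}ũ) = G_{j,loc}(ũ_{k+1}) + G_{j,loc}(ũ_{k+1})V_jG_{j,loc}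
(ũ_{k+1}ũ) + w′₆."* — DERIVED from the per-cube (5.6.11) with `w′₆` the defect `w6prime` (so the identity is exact by construction;
what print CLAIMS in addition is the size `O(e^{−cr(e_j)})` of `w′₆`). [cite: BalabanImbrieJaffe1988, (5.6.12) p.287] -/
theorem oneStep_w6prime (ζ'' : σ → σ → R) (lam : ι → σ → σ → R) {G G' V : ι → Matrix σ σ R}
    (h : ∀ α, G' α = G α + G α * V α * G' α) (Vj : Matrix σ σ R) :
    gLoc ζ'' lam G' = gLoc ζ'' lam G + gLoc ζ'' lam G * Vj * gLoc ζ'' lam G' + w6prime ζ'' lam G V G' Vj := by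
  rw [w6prime, gLoc_insert5611 ζ'' lam h]
  abel

/-- **(5.6.12) for `G_{j,loc}`, UNCONDITIONALLY given the per-cube (5.6.11)**: `G_{j,loc}(ũ_{k+1}ũ) = Σ_{n=0}^{n̄} G_{j,loc}(ũ_{k+1})
[V_jG_{j,loc}(ũ_{k+1})]ⁿ + G_{j,loc}(ũ_{k+1})[V_jG_{j,loc}(ũ_{k+1})]^{n̄}V_jG_{j,loc}(ũ_{k+1}ũ) + w₆` with `w₆ = Σ_{n≤n̄}(G_{j,loc}(ũ_{k+1})V_j)ⁿw′₆`
EXPLICIT. [cite: BalabanImbrieJaffe1988, (5.6.12) p.288] -/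
theorem eq5612_gLoc [DecidableEq σ] (ζ'' : σ → σ → R) (lam : ι → σ → σ → R) {G G' V : ι → Matrix σ σ R}
    (h : ∀ α, G' α = G α + G α * V α * G' α) (Vj : Matrix σ σ R) (N : ℕ) :
    gLoc ζ'' lam G' = (∑ n ∈ Finset.range (N + 1), gLoc ζ'' lam G * (Vj * gLoc ζ'' lam G) ^ n)
      + gLoc ζ'' lam G * (Vj * gLoc ζ'' lam G) ^ N * Vj * gLoc ζ'' lam G' + w6 (gLoc ζ'' lam G) Vj (w6prime ζ'' lam G V G' Vj) N :=
  eq5612_w6 (oneStep_w6prime ζ'' lam h Vj) N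

end W6prime

section Neumann

variable {P : Params} {j : ℕ} {ι τ : Type*} [Fintype ι] [Fintype τ]

/-- **(5.6.12) with `w₆` for the operators of record**: with `G_α = G_j(□_α, ũ_{k+1})`, `G′_α = G_j(□_α, ũ_{k+1}ũ)` the inverses of this
seat's `hMat` (`−Δ^N_{u,□_α} + a_jP_j`, Neumann cut-off `chiN □_α`) at `u` and at `ue^{a}`, `V_α = V_j(□_α)` the COMPUTED `vjMat` of (5.6.10)
(per-cube (5.6.11) = `BIJ88Vj5610Operator.eq5611_matrix`), and `V_j = V_j(Ω)` for any region `Ω`: (5.6.12) holds for every `n̄` with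
`w₆ = Σ_{n≤n̄}(G_{j,loc}(ũ_{k+1})V_j)ⁿw′₆`. [cite: BalabanImbrieJaffe1988, (5.6.12) p.288] -/
theorem eq5612_neumann (ζ'' : Balaban1983to89.Site P j → Balaban1983to89.Site P j → ℂ)
    (lam : ι → Balaban1983to89.Site P j → Balaban1983to89.Site P j → ℂ) (cube : ι → Finset (Balaban1983to89.Site P j))
    (Ω : Finset (Balaban1983to89.Site P j)) (aj c : ℝ) (u a : PBond P j → ℂ) (B : τ → Finset (Balaban1983to89.Site P j)) (w : ℝ)
    (U A : τ → Balaban1983to89.Site P j → ℂ)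
    {G G' : ι → Matrix (Balaban1983to89.Site P j) (Balaban1983to89.Site P j) ℂ}
    (hG : ∀ α, G α * hMat aj c u (chiN (cube α)) B w U = 1)
    (hG' : ∀ α, hMat aj c (fun b => u b * exp (a b)) (chiN (cube α)) B w (fun y x => U y x * exp (A y x)) * G' α = 1) (N : ℕ) :
    let Vj := vjMat aj c u a (chiN Ω) B w U A
    let V := fun α => vjMat aj c u a (chiN (cube α)) B w U A
    gLoc ζ'' lam G' = (∑ n ∈ Finset.range (N + 1), gLoc ζ'' lam G * (Vj * gLoc ζ'' lam G) ^ n)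
      + gLoc ζ'' lam G * (Vj * gLoc ζ'' lam G) ^ N * Vj * gLoc ζ'' lam G' + w6 (gLoc ζ'' lam G) Vj (w6prime ζ'' lam G V G' Vj) N :=
  eq5612_gLoc ζ'' lam (fun α => eq5611_matrix aj c u a (chiN (cube α)) B w U A (hG α) (hG' α)) _ N

end Neumann

/-! ## §4 `w₆` is as small as `w′₆` -/

section Bounds

variable {R : Type*} [NormedRing R]

/-- **`‖w₆‖ ≤ (Σ_{n=0}^{N} θⁿ)·‖w′₆‖` for `‖g₀v‖ ≤ θ`** (any normed ring): *"another small kernel w₆"* ⇐ `w′₆` small and `G_{j,loc}V_j`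
bounded. [cite: BalabanImbrieJaffe1988, (5.6.12) p.288] -/
theorem norm_w6_le {g₀ v w' : R} {θ : ℝ} (hθ : ‖g₀ * v‖ ≤ θ) (N : ℕ) :
    ‖w6 g₀ v w' N‖ ≤ (∑ n ∈ Finset.range (N + 1), θ ^ n) * ‖w'‖ := by
  have hθ0 : 0 ≤ θ := (norm_nonneg _).trans hθ
  have hpow : ∀ n, ‖(g₀ * v) ^ n * w'‖ ≤ θ ^ n * ‖w'‖ := by
    intro n
    rcases Nat.eq_zero_or_pos n with rfl | hn
    · simp
    · calc ‖(g₀ * v) ^ n * w'‖ ≤ ‖(g₀ * v) ^ n‖ * ‖w'‖ := norm_mul_le _ _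
        _ ≤ ‖g₀ * v‖ ^ n * ‖w'‖ := by gcongr; exact norm_pow_le' _ hn
        _ ≤ θ ^ n * ‖w'‖ := by gcongr
  unfold w6
  calc ‖∑ n ∈ Finset.range (N + 1), (g₀ * v) ^ n * w'‖ ≤ ∑ n ∈ Finset.range (N + 1), ‖(g₀ * v) ^ n * w'‖ := norm_sum_le _ _
    _ ≤ ∑ n ∈ Finset.range (N + 1), θ ^ n * ‖w'‖ := Finset.sum_le_sum fun n _ => hpow n
    _ = (∑ n ∈ Finset.range (N + 1), θ ^ n) * ‖w'‖ := by rw [Finset.sum_mul]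

/-- kernel: `‖w₆‖ ≤ (n̄+1)‖w′₆‖` when `‖g₀v‖ ≤ 1`. [cite: BalabanImbrieJaffe1988, (5.6.12) p.288] -/
theorem norm_w6_le_of_le_one {g₀ v w' : R} (h1 : ‖g₀ * v‖ ≤ 1) (N : ℕ) : ‖w6 g₀ v w' N‖ ≤ (N + 1) * ‖w'‖ := by
  have := norm_w6_le (w' := w') h1 N
  simpa using this

/-- kernel: `‖w₆‖ ≤ ‖w′₆‖/(1 − θ)` uniformly in `n̄` when `‖g₀v‖ ≤ θ < 1` (geometric series). [cite: BalabanImbrieJaffe1988, (5.6.12) p.288] -/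
theorem norm_w6_le_geom {g₀ v w' : R} {θ : ℝ} (hθ : ‖g₀ * v‖ ≤ θ) (hθ1 : θ < 1) (N : ℕ) :
    ‖w6 g₀ v w' N‖ ≤ ‖w'‖ / (1 - θ) := by
  have hθ0 : 0 ≤ θ := (norm_nonneg _).trans hθ
  have hgeom : ∑ n ∈ Finset.range (N + 1), θ ^ n ≤ 1 / (1 - θ) := by
    rw [le_div_iff₀ (by linarith), geom_sum_mul_neg]
    linarith [pow_nonneg hθ0 (N + 1)]
  calc ‖w6 g₀ v w' N‖ ≤ (∑ n ∈ Finset.range (N + 1), θ ^ n) * ‖w'‖ := norm_w6_le hθ N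
    _ ≤ 1 / (1 - θ) * ‖w'‖ := by gcongr
    _ = ‖w'‖ / (1 - θ) := by rw [one_div, inv_mul_eq_div]

end Bounds

section MatrixBounds

open scoped Matrix.Norms.Operator

variable {σ : Type*} [Fintype σ] [DecidableEq σ]

/-- **`w₆` for KERNELS** (complex matrices on a finite site set, `ℓ^∞`-operator norm = maximal row sum `sup_{x₁}Σ_{x₂}|K(x₁,x₂)|`, Mathlib's
scoped `Matrix.Norms.Operator`): `‖w₆‖ ≤ (Σ_{n≤n̄} θⁿ)‖w′₆‖` for `‖G_{j,loc}V_j‖ ≤ θ`. [cite: BalabanImbrieJaffe1988, (5.6.12) p.288] -/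
theorem norm_w6_matrix_le {g₀ v w' : Matrix σ σ ℂ} {θ : ℝ} (hθ : ‖g₀ * v‖ ≤ θ) (N : ℕ) :
    ‖w6 g₀ v w' N‖ ≤ (∑ n ∈ Finset.range (N + 1), θ ^ n) * ‖w'‖ :=
  norm_w6_le hθ N

/-- kernel: the row-sum reading of the norm used above — `‖K‖ = sup_{x₁} Σ_{x₂} ‖K(x₁,x₂)‖` (Mathlib `Matrix.linfty_opNorm_def`).
[cite: BalabanImbrieJaffe1988, (5.6.12) p.288] -/
theorem norm_eq_rowSum (K : Matrix σ σ ℂ) :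
    ‖K‖ = ((Finset.univ.sup fun x₁ => ∑ x₂, ‖K x₁ x₂‖₊ : NNReal) : ℝ) :=
  Matrix.linfty_opNorm_def K

end MatrixBounds

end

end Literature.MathematicalPhysics.QuantumFieldTheory.BalabanImbrieJaffe1984to88.BIJ88Eq5612W6
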